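import Summits.QuantumFields.YangMills.Theorems.UnitScaleTiltHalvingStepOfPillarsCEMemberExists
import Summits.QuantumFields.YangMills.Theorems.UnitScaleTiltProp8HalvingDressingLetterChartOfRecordClosedAllSizesAllL
import Summits.QuantumFields.YangMills.Theorems.UnitScaleTiltProp8HalvingA1Row165AllSizesAllL
import Summits.QuantumFields.YangMills.Theorems.UnitScaleTiltHalvingCompetitorMapFibreLocal
import Summits.QuantumFields.YangMills.Theorems.UnitScaleTiltProp8ChartDressedCompetitorSet
import Summits.QuantumFields.YangMills.Theorems.UnitScaleTiltHalvingStepOfPillarsCENear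
import Summits.QuantumFields.YangMills.Theorems.UnitScaleTiltHalvingStepOfPillarsCESU2Gauge
import Summits.QuantumFields.YangMills.Theorems.UnitScaleTiltHalvingP1FlatCoreTopCubeGeometry
import HarnessLib

/-!
# Route `UnitScaleTilt`, crux K1 child «MinimiserStabilityRegPr» (stmt-QuantumFields-19200), registered stub V2′ `stub_halvingStep` (skeleton v10 `BirthV10`) —
# (K-E2E) door, C_E end, lemma L4: **THE C_E BINDER `hCE′` OF THE H-DOOR ✓`HalvingStepOfPillarsPrime.halvingStep_of_rows'` (= `hCE` of
# ✓`HalvingStepOfPillars.halvingStep_of_rows`, ★w3-19200 g4) IS A THEOREM, WITH NO DISPLAYED HYPOTHESIS** — the plan memo `KE2E-CE-L4-PLAN-w8s2.md`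
# (evidence #41 on stmt-QuantumFields-19200) of ★w8-19200 g0∕s2 executed on the landed suppliers: FILE E closed and floor-free (✓`…ChartOfRecordClosedAllSizesAllL`),
# the (165)-row for every size (✓`…A1Row165AllSizesAllL`, ★w7-19200 g0), L3′ with the `∃`-gauge (Φ-1′) binder (✓`…CEMemberExists`, ★w1-19200 g7 after ★w8 s2's L3),
# B4 §3 (✓`…CompetitorMapFibreLocal.exists_gaugeAct_mem_fibre_of_chart49`, ★w1-19200 g7), the □₀ geometry of LEAD-H RULING L-6 (✓`…P1FlatCoreTopCubeGeometry`, ym-inputs-p09;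
# ✓`…HalvingStepOfPillarsCENear`, ★w7-19200 g1) and the `U(2) → SU(2)` normalisation of the P1♭′ chart pair (✓`…HalvingStepOfPillarsCESU2Gauge`, ★w7-19200 g1)

Cell `ym3-torus` (HUMAN RULING D-0037, YM ladder rung R3 — continuum SU(2) YM₃ on the torus is a RUNG, not the Clay problem), width seat `ym-ust-19200-w8` gen 2
(D-0154 (3c)).  `--supports stmt-QuantumFields-19200 --as helper`; count-neutral; def-free, 0 sorry, standard axioms.  NOT a claim about the stub, the crux, the rung or
the mass gap; no summit statement is proved by this seat.  After this file the H-door's three binders read: `hP2` ✓ (`FlatOpsAdmAtMSAllL.hP2_holds`), `hCE`∕`hCE′` ✓ (here),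
`hP1`∕`hP1room` OPEN (the J-chain ∕ WANTED №g26-5 `core′`; and `hP1` as typed in ✓p623036 is refuted at wrapping members by ✓`…WrapObstruction.hP1_false`, RULING №27).

THE KNIT (numbers, not adjectives).  Per odd `L = ℓ + 1 > 1` and P2 data `(R₀ M₀ B₀ δ₀ B₃, hP2)`:
* the two member-uniform suppliers — FILE E closed: `Mh₀ᴱ R₀ᴱ B_H C_X K₀ C_P`, `ε Rc₀ a₃` with the seven windows (`a₃ ≤ Rc₀ < ε`, `3ε ≤ R_s∕4`, `(1 + 4B_HC₂♭ε)ε ≤ R′ ≤ R_s∕4`,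
  `(1 + 4B_HC₂♭Rc₀)a₃ ≤ 1∕(2L)`), and the (165)-row: `Mh₀ʳ R₀ʳ B₀ʳ B_M`; thresholds `M₁ := L·max (max Mh₀ᴱ Mh₀ʳ) 1`, `R₁ := max (max R₀ᴱ R₀ʳ) (2L)`;
* the size seam: `M = L^{aₑ} ≥ M₁ ≥ L` forces `aₑ = a′ + 1`, `M = L·L^{a′}` (`subst`), so the suppliers' `Mh := L^{a′}`;
* given `B₁ ≥ 0`: `a_CE := min (min 1 (10⁷L³)⁻¹) (a₃ ∕ (2(1 + B_HC₂♭)(B₁ + 1)))`, `Cce := 0`, `C₂ := L·((1 + B_HC₂♭)B₁)`, `K₁ := max B₀ʳ (1+B_M)·4C₄·((1 + B_HC₂♭)B₁)²`,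
  `K₂ := B₀B₃C₂♭B₁²` (`C₂♭ = 64L∕R_s`, `C₄` = FILE E's explicit (165)-letter constant);
* per member `F = ⟨ℓ+1, _, m, hm⟩` (`cases F; subst`), heights, `ε`'s, datum, minimiser `U ∈ regFibrePr`, site `x` and P1♭′ pair `(u, A)` with its seven conjuncts: the weights
  of record; P2's rows at the member (`H = flatH` by ✓`isFlatH_flatH`); FILE E's `Hs Dsel W₀` read at the member's carrier; the (165) implication; ✓`exists_su2Chart_continuous`;
  the `δ := B₁ε₀` numerics (`δ(1 + B_HC₂♭) ≤ a₃∕2`, `δ < R_s∕4`, `r₁ := a₃ ≤ ε`, `a₃ + 4B_HC₂♭ε² ≤ R_s`, `10⁷L³ε₀ ≤ 1`); B3 + ✓`aPrime_rows` (`A′ := A + Hs(C♭A)` in the `a₃`-ball);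
  `Dsel A′ = C♭A` by FILE E's uniqueness; (Φ-2′) `hchartNear` from hCE′'s own (ii′) + `tr A = 0` by ✓`hchartNear_of_hii`; **(Φ-1′) DISCHARGED**: for every regular dressed
  competitor `exists_gaugeAct_mem_fibre_of_chart49` with `Near := □₀ × □₀` (✓`near_of_bondIdx`, ✓`near_of_mem_Om_succ`), the dressed competitors being 𝔰𝔲(2)-valued by
  ✓`dressed_competitor_su2`; then ✓`ceRows_at_member_exists` (`Tch`∕`hTN`∕`hTF` := ✓`near_sides_of_touch`∕✓`lamBond_sides_of_not_touch`), the far row relaxed to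
  `C₂ε₀L^{k−j}` and `e₁ ≤ K₁ε₀²`, `e₃ = K₂ε₀²` by the abstract-letter lemmas of §1 read across the `F.P K`∕`PV` letters by `le_rfl`.
HONEST SCOPE.  Constants bookkeeping and plumbing over the landed lemmas named above; the analysis is theirs.  The conclusion is the door's `hCE′` text byte for byte.

References: T. Bałaban, CMP **102** (1985) 277–309 [Balaban1985Variational] (44)–(49) p.285, (55) p.286, (99) p.293, (144) p.300, (150)–(168) pp.301–304,
Prop. 8 p.304; CMP **99** (1985) 75–102 [Balaban1985RegularSpaces] Thm 2 p.83; CMP **98** (1985) 17–51 [Balaban1985Averaging] Prop. 5 (157) p.42. -/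

set_option autoImplicit false

noncomputable section

open scoped BigOperators Matrix Matrix.Norms.L2Operator
open NormedSpace

namespace Summit.QuantumFields.YangMills.Theorems.HalvingSitePackage

open Literature.MathematicalPhysics.QuantumFieldTheory.Balaban1983to89
open Literature.MathematicalPhysics.QuantumFieldTheory.Balaban1983to89.T3ContinuumYM3Torus
open Literature.MathematicalPhysics.QuantumFieldTheory.Balaban1983to89.T3PrintedRegularMinimiser
open Literature.MathematicalPhysics.QuantumFieldTheory.Balaban1983to89.T3Thm1Carrier
open Complex (I)
open B5Eq117TorusCarriers (Mk)
open B5Eq118OneStroke (iterBlockOf)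
open B5Prop12FieldsLattice (distSite)
open B6GlobalChartV1 (PV)
open B6SectADomainsV1 (Domains)
open B6SectAOperatorsV1 (BondIdx SiteIdx QE RE dsE)
open B7Prop1Explicit (expUnit)
open B8Ineq132 (BondTouches)
open B8Eq140Level (SideTouches)
open B8Eq143PlaqExpansion (pdiv)
open B8Eq146AExpansion (plaqCovDeriv)
open B8Thm2SetupTorus (pullDom)
open B10Eq27TorusAxialLog (pull unitsField toUField transl)
open B11Eq115Space (levOf)
open LatticeFieldCalculus (bondAvgIter laplace diverg siteAvgIter)
open FlatCubeOpsText (Adm22 IsLevWeight FlatOpsAdmAtMS HDecayLetterD RowSum162 distBI)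
open FlatOpsLettersAssembly (flatH isFlatH_flatH levWeight_nonneg)
open FlatCubeSequenceAligned (cubeSeqMT3 cubeSeqMT3_k cubeSetM)
open FlatCubeSequenceAdm (adm22_cubeSeqMT3)
open HalvingP1FlatPillar (DP1Clause)
open Prop8ChartDoubleBar (chartLogFlat chartRemainderFlat_hCd_hCq_B1 dressed_competitor_su2)
open HalvingDressingLetter (exists_hWq_dressed_cubeSeq_T3_chartOfRecord_closed_allSizes_allL)
open HalvingA1Row165AllSizesAllL (row165_of_tracePairing_su2_allSizes_allL)
open HalvingCompetitorMapFibreLocal (exists_gaugeAct_mem_fibre_of_chart49)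
open HalvingCENear (near_sides_of_touch lamBond_sides_of_not_touch hchartNear_of_hii')
open P1FlatCoreTopCubeGeometry (near_of_bondIdx near_of_mem_Om_succ)

/-! ## §1 Numerics (abstract letters) -/
/-- `δ + B_H q δ² ≤ (1 + B_H C₂♭)·B₁·ε₀` for `δ = B₁ε₀ ≤ 1`, `0 ≤ q ≤ C₂♭`. [folklore] -/
theorem r_le_of_delta_le_one {BH q C2 B₁ ε₀ : ℝ} (hBH : 0 ≤ BH) (hq : 0 ≤ q) (hqC : q ≤ C2) (hB₁ : 0 ≤ B₁) (hε₀ : 0 ≤ ε₀)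
    (hδ1 : B₁ * ε₀ ≤ 1) : B₁ * ε₀ + BH * (q * (B₁ * ε₀) ^ 2) ≤ (1 + BH * C2) * B₁ * ε₀ := by
  have hδ : 0 ≤ B₁ * ε₀ := mul_nonneg hB₁ hε₀
  have hsq : (B₁ * ε₀) ^ 2 ≤ B₁ * ε₀ := by nlinarith
  have h1 : BH * (q * (B₁ * ε₀) ^ 2) ≤ BH * (C2 * (B₁ * ε₀)) :=
    mul_le_mul_of_nonneg_left ((mul_le_mul_of_nonneg_left hsq hq).trans (mul_le_mul_of_nonneg_right hqC hδ)) hBH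
  nlinarith

/-- The `e₁` bookkeeping: `max B₀ʳ (1+B_M)·4C·(δ + B_H q δ²)² ≤ K₁ ε₀²` for `δ = B₁ε₀ ≤ 1`, `C ≤ C₄`, `q ≤ C₂♭`. [folklore] -/
theorem e₁_bound {B₀r BM BH C C₄ q C2 B₁ ε₀ : ℝ} (hB₀r : 0 ≤ B₀r) (hBH : 0 ≤ BH) (hC : 0 ≤ C) (hCC : C ≤ C₄)
    (hq : 0 ≤ q) (hqC : q ≤ C2) (hB₁ : 0 ≤ B₁) (hε₀ : 0 ≤ ε₀) (hδ1 : B₁ * ε₀ ≤ 1) :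
    max B₀r (1 + BM) * (4 * C * (B₁ * ε₀ + BH * (q * (B₁ * ε₀) ^ 2)) ^ 2) ≤
      max B₀r (1 + BM) * (4 * C₄ * ((1 + BH * C2) * B₁) ^ 2) * ε₀ ^ 2 := by
  have hm : 0 ≤ max B₀r (1 + BM) := le_max_of_le_left hB₀r
  have hr0 : 0 ≤ B₁ * ε₀ + BH * (q * (B₁ * ε₀) ^ 2) := by positivity
  have hr2 : (B₁ * ε₀ + BH * (q * (B₁ * ε₀) ^ 2)) ^ 2 ≤ ((1 + BH * C2) * B₁) ^ 2 * ε₀ ^ 2 :=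
    (pow_le_pow_left₀ hr0 (r_le_of_delta_le_one hBH hq hqC hB₁ hε₀ hδ1) 2).trans_eq (by ring)
  have h4 : 4 * C * (B₁ * ε₀ + BH * (q * (B₁ * ε₀) ^ 2)) ^ 2 ≤ 4 * C₄ * (((1 + BH * C2) * B₁) ^ 2 * ε₀ ^ 2) :=
    (mul_le_mul_of_nonneg_left hr2 (by positivity)).trans (mul_le_mul_of_nonneg_right (by linarith) (by positivity))
  exact (mul_le_mul_of_nonneg_left h4 hm).trans_eq (by ring)

/-! ## §2 The theorem -/
-- heartbeat budget (HOME README rule): the L3′ call unifies ~60 binders across the `F.P K`∕`PV` letters (isDefEq-heavy; 200k fails, 400k passes in 45 s farm wall); budgeted 400k on this declaration only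
set_option maxHeartbeats 400000 in
/-- ★★ **L4: THE C_E ROWS OF THE H-DOOR, AS A THEOREM** — the `hCE′` binder of ✓`HalvingStepOfPillarsPrime.halvingStep_of_rows'` (= `hCE` of
✓`HalvingStepOfPillars.halvingStep_of_rows`) VERBATIM: for every odd `L > 1` and the P2 data, thresholds `M₁ R₁`, and for the cube-sequence geometry and the
P1♭ size constant `B₁` the constants `K₁ K₂ C₂ Cce a_CE`, such that at every member, heights, `ε`'s, datum, minimiser, site and P1♭′ pair `(u, A)` the rows of
✓`sitePackage_of_rows` hold for FILE E's `Hs`, `C := C♭` and explicit `e₁ ≤ K₁ε₀²`, `e₃ ≤ K₂ε₀²`.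
[cite: Balaban1985Variational, (44)-(49) p.285, (55) p.286, (99) p.293, (150)-(165) pp.301-303, Prop. 8 p.304; Balaban1985RegularSpaces, Thm 2 p.83] -/
theorem ceRows_of_chart :
    ∀ L : ℕ, Odd L → 1 < L → ∀ (R₀ M₀ : ℕ) (B₀ δ₀ B₃ : ℝ), 0 < B₀ → 0 < δ₀ → 0 < B₃ → FlatOpsAdmAtMS L R₀ M₀ B₀ δ₀ B₃ →
      ∃ (M₁ R₁ : ℕ), ∀ (R M aₑ S : ℕ) (hM : 1 ≤ M), M = L ^ aₑ → M₁ ≤ M → M₀ ≤ M → R₁ ≤ R → R₀ ≤ R → R * M ≤ S →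
      ∀ B₁ : ℝ, 0 ≤ B₁ →
      ∃ (K₁ K₂ C₂ Cce aCE : ℝ), 0 ≤ K₁ ∧ 0 ≤ K₂ ∧ 0 ≤ C₂ ∧ 0 ≤ Cce ∧ 0 < aCE ∧
      ∀ ρ : ℕ, 1 ≤ ρ → ∀ F : T3Family, F.L = L → ∀ (n K : ℕ) (hnK : n < K) (ε₀ ε₁ : ℝ), 0 < ε₁ → 0 < ε₀ → ε₀ ≤ aCE → Cce * ε₁ ≤ ε₀ →
        ∀ V : GaugeField (F.P n) 0 (Matrix.specialUnitaryGroup (Fin 2) ℂ), PlaqSmall ε₁ V →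
          ∀ U ∈ regFibrePr F n K hnK.le ε₀ V,
            IsMinOn (fun W : GaugeField (F.P K) 0 (Matrix.specialUnitaryGroup (Fin 2) ℂ) => wilsonAction4 W) (regFibrePr F n K hnK.le ε₀ V) U →
            ∀ (x : Site (F.P K) 0) (C₂' : ℝ) (u : GaugeTransf (F.P K) 0 (Matrix.unitaryGroup (Fin 2) ℂ)) (A : PBond (F.P K) 0 → Matrix (Fin 2) (Fin 2) ℂ),
              -- the seven conjuncts of `P1FlatPillarAt' F n K (cubeSeqMT3 …) (cubeSetM x (K−n) ρ S M 0) x ε₀ ε₁ B₁ 6 C₂' U` for THIS pair `(u, A)` ((ii′) on `□₀`)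
              DP1Clause F n K (cubeSeqMT3 F n K x ρ S M hM) x U u →
              (∀ b : PBond (F.P K) 0, IsSelfAdjoint (A b)) → (∀ b : PBond (F.P K) 0, Matrix.trace (A b) = 0) →
              (∀ (z : B7Prop1Explicit.Site (F.P K).d) (μ : Fin (F.P K).d),
                transl (0 : Site (F.P K) 0) z ∈ cubeSetM x (K - n) ρ S M 0 → (transl (0 : Site (F.P K) 0) z).shift μ ∈ cubeSetM x (K - n) ρ S M 0 →
                (Unitary.toUnits (u (transl 0 z)))⁻¹ * unitsField (toUField U) ⟨transl 0 z, μ⟩ * Unitary.toUnits (u ((transl 0 z).shift μ)) =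
                  expUnit (I • ((((F.L : ℝ)⁻¹) ^ (K - n)) • A ⟨transl 0 z, μ⟩))) →
              (∀ w : ℕ → PBond (F.P K) 0 → ℝ, IsLevWeight F n K (cubeSeqMT3 F n K x ρ S M hM) w →
                (∀ b : PBond (F.P K) 0, w 1 b * ‖A b‖ ≤ B₁ * ε₀) ∧
                (∀ (b : PBond (F.P K) 0) (ν : Fin (F.P K).d), w 2 b * (F.L : ℝ) ^ (K - n) * ‖A ⟨b.src.shift ν, b.dir⟩ - A b‖ ≤ B₁ * ε₀)) →
              (∃ μ : SiteIdx (cubeSeqMT3 F n K x ρ S M hM) → Matrix (Fin 2) (Fin 2) ℂ, ∀ s : Site (F.P K) 0,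
                laplace ((F.L : ℝ) ^ (K - n)) (diverg ((F.L : ℝ) ^ (K - n)) A) s =
                  ∑ i : SiteIdx (cubeSeqMT3 F n K x ρ S M hM), siteAvgIter (i.1.1 : ℕ) (Pi.single s (1 : ℝ)) i.1.2 • μ i) →
              (∀ c : BondIdx (cubeSeqMT3 F n K x ρ S M hM), (c.1.1 : ℕ) = K - n →
                c.1.2.src ∈ (cubeSeqMT3 F n K x ρ S M hM).Om (c.1.1 : ℕ) → c.1.2.tgt ∈ (cubeSeqMT3 F n K x ρ S M hM).Om (c.1.1 : ℕ) →
                ‖chartLogFlat (((F.L : ℝ)⁻¹) ^ (K - n)) (cubeSeqMT3 F n K x ρ S M hM) A c‖ ≤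
                  6 * ε₁ * (distSite (Mk (F.P K) (c.1.1 : ℕ)) c.1.2.src (iterBlockOf (c.1.1 : ℕ) x) + 1)) →
              (∀ c : BondIdx (cubeSeqMT3 F n K x ρ S M hM), ‖chartLogFlat (((F.L : ℝ)⁻¹) ^ (K - n)) (cubeSeqMT3 F n K x ρ S M hM) A c‖ ≤ C₂' * ε₀) →
              -- OUTPUT: `sitePackage_of_rows`'s rows for some `Hs`, `C`, `e₁`, `e₃`
              ∃ (Hs : (BondIdx (cubeSeqMT3 F n K x ρ S M hM) → Matrix (Fin 2) (Fin 2) ℂ) → (PBond (F.P K) 0 → Matrix (Fin 2) (Fin 2) ℂ))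
                (C : (PBond (F.P K) 0 → Matrix (Fin 2) (Fin 2) ℂ) → (BondIdx (cubeSeqMT3 F n K x ρ S M hM) → Matrix (Fin 2) (Fin 2) ℂ))
                (e₁ e₃ : ℝ),
                ((∀ (z : B7Prop1Explicit.Site (F.P K).d) (τ : Fin (F.P K).d),
                    SideTouches (pullDom (fun j => if K - n ≤ j then ({x} : Set (Site (F.P K) 0)) else (∅ : Set (Site (F.P K) 0))) (K - n)) z τ →
                    ‖((A + Hs (C A)) - fun b : PBond (F.P K) 0 => ∑ c, flatH F n K (cubeSeqMT3 F n K x ρ S M hM) (Pi.single c 1) b •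
                        bondAvgIter (c.1.1 : ℕ) (A + Hs (C A)) c.1.2) ⟨transl 0 z, τ⟩‖ ≤ e₁) ∧
                  (∀ (z : B7Prop1Explicit.Site (F.P K).d) (κ τ : Fin (F.P K).d),
                    SideTouches (pullDom (fun j => if K - n ≤ j then ({x} : Set (Site (F.P K) 0)) else (∅ : Set (Site (F.P K) 0))) (K - n)) z τ →
                    ‖(((F.L : ℝ)⁻¹) ^ (K - n))⁻¹ •
                      (((A + Hs (C A)) - fun b : PBond (F.P K) 0 => ∑ c, flatH F n K (cubeSeqMT3 F n K x ρ S M hM) (Pi.single c 1) b •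
                          bondAvgIter (c.1.1 : ℕ) (A + Hs (C A)) c.1.2) ⟨(transl 0 z).shift κ, τ⟩ -
                        ((A + Hs (C A)) - fun b : PBond (F.P K) 0 => ∑ c, flatH F n K (cubeSeqMT3 F n K x ρ S M hM) (Pi.single c 1) b •
                          bondAvgIter (c.1.1 : ℕ) (A + Hs (C A)) c.1.2) ⟨transl 0 z, τ⟩)‖ ≤ e₁) ∧
                  (∀ (z : B7Prop1Explicit.Site (F.P K).d) (μ : Fin (F.P K).d),
                    BondTouches (pullDom (fun j => if K - n ≤ j then ({x} : Set (Site (F.P K) 0)) else (∅ : Set (Site (F.P K) 0))) (K - n)) z μ →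
                    ‖pdiv (((F.L : ℝ)⁻¹) ^ (K - n)) (1 : B7Prop1Explicit.Site (F.P K).d → Fin (F.P K).d → (Matrix (Fin 2) (Fin 2) ℂ)ˣ)
                        (plaqCovDeriv (((F.L : ℝ)⁻¹) ^ (K - n)) (1 : B7Prop1Explicit.Site (F.P K).d → Fin (F.P K).d → (Matrix (Fin 2) (Fin 2) ℂ)ˣ)
                          (pull ((A + Hs (C A)) - fun b : PBond (F.P K) 0 => ∑ c, flatH F n K (cubeSeqMT3 F n K x ρ S M hM) (Pi.single c 1) b •
                            bondAvgIter (c.1.1 : ℕ) (A + Hs (C A)) c.1.2) 0)) μ z‖ ≤ e₁)) ∧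
                ((∀ (z : B7Prop1Explicit.Site (F.P K).d) (τ : Fin (F.P K).d),
                    SideTouches (pullDom (fun j => if K - n ≤ j then ({x} : Set (Site (F.P K) 0)) else (∅ : Set (Site (F.P K) 0))) (K - n)) z τ →
                    ‖Hs (C A) ⟨transl 0 z, τ⟩‖ ≤ e₃) ∧
                  (∀ (z : B7Prop1Explicit.Site (F.P K).d) (κ τ : Fin (F.P K).d),
                    SideTouches (pullDom (fun j => if K - n ≤ j then ({x} : Set (Site (F.P K) 0)) else (∅ : Set (Site (F.P K) 0))) (K - n)) z τ →
                    ‖(((F.L : ℝ)⁻¹) ^ (K - n))⁻¹ • (Hs (C A) ⟨(transl 0 z).shift κ, τ⟩ - Hs (C A) ⟨transl 0 z, τ⟩)‖ ≤ e₃) ∧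
                  (∀ (z : B7Prop1Explicit.Site (F.P K).d) (μ : Fin (F.P K).d),
                    BondTouches (pullDom (fun j => if K - n ≤ j then ({x} : Set (Site (F.P K) 0)) else (∅ : Set (Site (F.P K) 0))) (K - n)) z μ →
                    ‖pdiv (((F.L : ℝ)⁻¹) ^ (K - n)) (1 : B7Prop1Explicit.Site (F.P K).d → Fin (F.P K).d → (Matrix (Fin 2) (Fin 2) ℂ)ˣ)
                        (plaqCovDeriv (((F.L : ℝ)⁻¹) ^ (K - n)) (1 : B7Prop1Explicit.Site (F.P K).d → Fin (F.P K).d → (Matrix (Fin 2) (Fin 2) ℂ)ˣ)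
                          (pull (Hs (C A)) 0)) μ z‖ ≤ e₃)) ∧
                (∀ c : BondIdx (cubeSeqMT3 F n K x ρ S M hM), (c.1.1 : ℕ) = K - n →
                  c.1.2.src ∈ (cubeSeqMT3 F n K x ρ S M hM).Om (c.1.1 : ℕ) → c.1.2.tgt ∈ (cubeSeqMT3 F n K x ρ S M hM).Om (c.1.1 : ℕ) →
                  ‖bondAvgIter (c.1.1 : ℕ) (A + Hs (C A)) c.1.2‖ ≤ 6 * ε₁ * (distSite (Mk (F.P K) (c.1.1 : ℕ)) c.1.2.src (iterBlockOf (c.1.1 : ℕ) x) + 1)) ∧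
                (∀ c : BondIdx (cubeSeqMT3 F n K x ρ S M hM),
                  ¬ ((c.1.1 : ℕ) = K - n ∧ c.1.2.src ∈ (cubeSeqMT3 F n K x ρ S M hM).Om (c.1.1 : ℕ) ∧
                      c.1.2.tgt ∈ (cubeSeqMT3 F n K x ρ S M hM).Om (c.1.1 : ℕ)) →
                  ‖bondAvgIter (c.1.1 : ℕ) (A + Hs (C A)) c.1.2‖ ≤ C₂ * ε₀ * (F.L : ℝ) ^ ((K - n) - (c.1.1 : ℕ))) ∧
                e₁ ≤ K₁ * ε₀ ^ 2 ∧ e₃ ≤ K₂ * ε₀ ^ 2 := by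

  classical
  intro L hodd hL1 R₀ M₀ B₀ δ₀ B₃ hB₀ hδ₀ hB₃ hP2L
  obtain ⟨ℓ, rfl⟩ : ∃ ℓ, L = ℓ + 1 := ⟨L - 1, by omega⟩
  have hLℓ : Odd (ℓ + 1) ∧ 1 < ℓ + 1 := ⟨hodd, hL1⟩
  obtain ⟨Mh₀E, R₀E, BH, CX, K₀, CP, hBH, hCX, hK₀, hCP, ε, Rc₀, a₃, ha₃, ha₃R, hRcε, h3ε, hq9, hR', hθ, hEall⟩ :=
    exists_hWq_dressed_cubeSeq_T3_chartOfRecord_closed_allSizes_allL ℓ hLℓ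
  obtain ⟨Mh₀r, R₀r, B₀r, BM, hB₀r, hBM, h165all⟩ := row165_of_tracePairing_su2_allSizes_allL ℓ hLℓ
  refine ⟨(ℓ + 1) * max (max Mh₀E Mh₀r) 1, max (max R₀E R₀r) (2 * (ℓ + 1)), ?_⟩
  intro R M aₑ S hM hMeq hM₁ hM₀ hR₁ hR₀ hRS B₁ hB₁
  -- the size seam: `M = L^{aₑ} ≥ L` forces `aₑ = a′ + 1`, `M = L·L^{a′}`
  have haₑ : aₑ ≠ 0 := by
    rintro rfl
    rw [pow_zero] at hMeq
    have : (ℓ + 1) * 1 ≤ (ℓ + 1) * max (max Mh₀E Mh₀r) 1 := Nat.mul_le_mul_left _ (le_max_right _ _)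
    omega
  obtain ⟨a', rfl⟩ := Nat.exists_eq_succ_of_ne_zero haₑ
  rw [pow_succ'] at hMeq
  subst hMeq
  have hMh : max (max Mh₀E Mh₀r) 1 ≤ (ℓ + 1) ^ a' := Nat.le_of_mul_le_mul_left hM₁ (Nat.succ_pos ℓ)
  have hMhE : Mh₀E ≤ (ℓ + 1) ^ a' := ((le_max_left _ _).trans (le_max_left _ _)).trans hMh
  have hMhr : Mh₀r ≤ (ℓ + 1) ^ a' := ((le_max_right _ _).trans (le_max_left _ _)).trans hMh
  have hR₀E : R₀E ≤ R := ((le_max_left _ _).trans (le_max_left _ _)).trans hR₁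
  have hR₀r : R₀r ≤ R := ((le_max_right _ _).trans (le_max_left _ _)).trans hR₁
  have hR2L : 2 * (ℓ + 1) ≤ R := (le_max_right _ _).trans hR₁
  have hRM : 2 * (ℓ + 1) ≤ R * ((ℓ + 1) * (ℓ + 1) ^ a') := hR2L.trans (Nat.le_mul_of_pos_right R hM)
  have hL0 : (0 : ℝ) < ((ℓ + 1 : ℕ) : ℝ) := by positivity
  have hL1r : (1 : ℝ) ≤ ((ℓ + 1 : ℕ) : ℝ) := by exact_mod_cast Nat.succ_le_succ (Nat.zero_le ℓ)
  have hden : (0 : ℝ) < 16 * 3800 * ((((2 + 1 + 2) * (ℓ + 1) : ℕ)) : ℝ) ^ 2 * ((ℓ + 1 : ℕ) : ℝ) := by positivity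
  have hRs0 : (0 : ℝ) < (16 * 3800 * ((((2 + 1 + 2) * (ℓ + 1) : ℕ)) : ℝ) ^ 2 * ((ℓ + 1 : ℕ) : ℝ))⁻¹ := inv_pos.2 hden
  have hC2f0 : (0 : ℝ) ≤ 64 * ((ℓ + 1 : ℕ) : ℝ) / (16 * 3800 * ((((2 + 1 + 2) * (ℓ + 1) : ℕ)) : ℝ) ^ 2 * ((ℓ + 1 : ℕ) : ℝ))⁻¹ := by positivity
  -- `0 < Rc₀`, `0 < ε` (read by `positivity` below)
  have hRc0 : 0 < Rc₀ := ha₃.trans_le ha₃R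
  have hε0 : 0 < ε := hRc0.trans hRcε
  have ha₃1 : a₃ ≤ 1 := by
    have h0 : 0 ≤ 4 * BH * (64 * ((ℓ + 1 : ℕ) : ℝ) / (16 * 3800 * ((((2 + 1 + 2) * (ℓ + 1) : ℕ)) : ℝ) ^ 2 * ((ℓ + 1 : ℕ) : ℝ))⁻¹) * Rc₀ := by
      positivity
    have h2 := le_mul_of_one_le_left ha₃.le (le_add_of_nonneg_right h0)
    have h3 : 1 / (2 * ((ℓ + 1 : ℕ) : ℝ)) ≤ 1 := by rw [div_le_one (by positivity)]; linarith only [hL1r]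
    linarith only [h2, hθ, h3]
  -- the C_E constants
  set C2f : ℝ := 64 * ((ℓ + 1 : ℕ) : ℝ) / (16 * 3800 * ((((2 + 1 + 2) * (ℓ + 1) : ℕ)) : ℝ) ^ 2 * ((ℓ + 1 : ℕ) : ℝ))⁻¹ with hC2fdef
  set C₄ℓ : ℝ := (12 * (((ℓ + 1 : ℕ) : ℝ) ^ 3 * (1428 + ((ℓ + 1 : ℕ) : ℝ))) * (1 + 4 * BH * (64 * ((ℓ + 1 : ℕ) : ℝ) / (16 * 3800 * ((((2 + 1 + 2) * (ℓ + 1) : ℕ)) : ℝ) ^ 2 * ((ℓ + 1 : ℕ) : ℝ))⁻¹) * Rc₀) ^ 2 +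
              (2 * CX * (64 * ((ℓ + 1 : ℕ) : ℝ) / (16 * 3800 * ((((2 + 1 + 2) * (ℓ + 1) : ℕ)) : ℝ) ^ 2 * ((ℓ + 1 : ℕ) : ℝ))⁻¹) + 2⁻¹ * (8 * (7 * (9830400000 * ((ℓ + 1 : ℕ) : ℝ) ^ 4) * (1 + 4 * BH * (64 * ((ℓ + 1 : ℕ) : ℝ) / (16 * 3800 * ((((2 + 1 + 2) * (ℓ + 1) : ℕ)) : ℝ) ^ 2 * ((ℓ + 1 : ℕ) : ℝ))⁻¹) * ε)) * (2 * CP)) * (1 + 4 * BH * (64 * ((ℓ + 1 : ℕ) : ℝ) / (16 * 3800 * ((((2 + 1 + 2) * (ℓ + 1) : ℕ)) : ℝ) ^ 2 * ((ℓ + 1 : ℕ) : ℝ))⁻¹) * Rc₀) +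
                (16 * K₀ * (7 * (9830400000 * ((ℓ + 1 : ℕ) : ℝ) ^ 4) * (1 + 4 * BH * (64 * ((ℓ + 1 : ℕ) : ℝ) / (16 * 3800 * ((((2 + 1 + 2) * (ℓ + 1) : ℕ)) : ℝ) ^ 2 * ((ℓ + 1 : ℕ) : ℝ))⁻¹) * ε))) * Rc₀ * (12 * (((ℓ + 1 : ℕ) : ℝ) ^ 3 * (1428 + ((ℓ + 1 : ℕ) : ℝ)))) * (1 + 4 * BH * (64 * ((ℓ + 1 : ℕ) : ℝ) / (16 * 3800 * ((((2 + 1 + 2) * (ℓ + 1) : ℕ)) : ℝ) ^ 2 * ((ℓ + 1 : ℕ) : ℝ))⁻¹) * Rc₀) ^ 2)) with hC₄ℓdef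
  have hC₄ℓ0 : 0 ≤ C₄ℓ := by rw [hC₄ℓdef]; positivity
  set aCE : ℝ := min (10 ^ 7 * ((ℓ + 1 : ℕ) : ℝ) ^ 3)⁻¹ (a₃ / (2 * (1 + BH * C2f) * (B₁ + 1))) with haCEdef
  have hBC : 0 < 2 * (1 + BH * C2f) * (B₁ + 1) := by positivity
  have haCE0 : 0 < aCE := lt_min (by positivity) (div_pos ha₃ hBC)
  refine ⟨max B₀r (1 + BM) * (4 * C₄ℓ * ((1 + BH * C2f) * B₁) ^ 2), B₀ * B₃ * C2f * B₁ ^ 2,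
    ((ℓ + 1 : ℕ) : ℝ) * ((1 + BH * C2f) * B₁), 0, aCE, by positivity, by positivity, by positivity, le_rfl, haCE0, ?_⟩
  intro ρ hρ1 F hF n K hnK ε₀ ε₁ hε₁ hε₀ hε₀a _hce V _hV U hU hmin x C₂' u A _ho hsa htr hii hiii hiv hvi _hvii
  -- the member seam
  obtain ⟨L', hLF, m, hm⟩ := F
  change L' = ℓ + 1 at hF
  subst hF
  -- numerics at this member: `δ := B₁ε₀`
  have hε₀aCE : ε₀ ≤ aCE := hε₀a
  have haCEa : aCE ≤ a₃ / (2 * (1 + BH * C2f) * (B₁ + 1)) := min_le_right _ _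
  have hδ0 : 0 ≤ B₁ * ε₀ := mul_nonneg hB₁ hε₀.le
  have hε7 : 10 ^ 7 * ((ℓ + 1 : ℕ) : ℝ) ^ 3 * ε₀ ≤ 1 := by
    have h7 : (0 : ℝ) < 10 ^ 7 * ((ℓ + 1 : ℕ) : ℝ) ^ 3 := by positivity
    exact (mul_le_mul_of_nonneg_left (hε₀aCE.trans (min_le_left _ _)) h7.le).trans_eq (mul_inv_cancel₀ h7.ne')
  -- `δ(1 + B_H C₂♭) ≤ a₃/2`
  have hδt : (B₁ * ε₀) * (1 + BH * C2f) ≤ a₃ / 2 := by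
    have h1 : B₁ * ε₀ ≤ B₁ * aCE := mul_le_mul_of_nonneg_left hε₀aCE hB₁
    have h2 : B₁ * aCE ≤ B₁ * (a₃ / (2 * (1 + BH * C2f) * (B₁ + 1))) := mul_le_mul_of_nonneg_left haCEa hB₁
    have h3 : B₁ * (a₃ / (2 * (1 + BH * C2f) * (B₁ + 1))) * (1 + BH * C2f) = (a₃ / 2) * (B₁ / (B₁ + 1)) := by
      field_simp
    have h4 : B₁ / (B₁ + 1) ≤ 1 := by rw [div_le_one (by linarith only [hB₁])]; linarith only [hB₁]
    have h5 : 0 ≤ 1 + BH * C2f := by positivity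
    calc (B₁ * ε₀) * (1 + BH * C2f) ≤ B₁ * (a₃ / (2 * (1 + BH * C2f) * (B₁ + 1))) * (1 + BH * C2f) :=
          mul_le_mul_of_nonneg_right (h1.trans h2) h5
      _ = (a₃ / 2) * (B₁ / (B₁ + 1)) := h3
      _ ≤ (a₃ / 2) * 1 := mul_le_mul_of_nonneg_left h4 (by linarith only [ha₃])
      _ = a₃ / 2 := mul_one _
  have hδa : B₁ * ε₀ ≤ a₃ / 2 := by
    have : B₁ * ε₀ ≤ (B₁ * ε₀) * (1 + BH * C2f) := le_mul_of_one_le_right hδ0 (by linarith only [mul_nonneg hBH hC2f0])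
    exact this.trans hδt
  have hδ1 : B₁ * ε₀ ≤ 1 := by linarith only [hδa, ha₃1]
  have hδε : B₁ * ε₀ ≤ ε := by linarith only [hδa, ha₃, ha₃R, hRcε]
  have hr_lt : B₁ * ε₀ + BH * (C2f * (B₁ * ε₀) ^ 2) < a₃ := by
    have h1 : BH * (C2f * (B₁ * ε₀) ^ 2) ≤ BH * (C2f * (B₁ * ε₀)) :=
      mul_le_mul_of_nonneg_left (mul_le_mul_of_nonneg_left (by nlinarith only [hδ0, hδ1]) hC2f0) hBH
    have h2 : B₁ * ε₀ + BH * (C2f * (B₁ * ε₀)) = (B₁ * ε₀) * (1 + BH * C2f) := by ring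
    linarith only [h1, h2, hδt, ha₃]
  have hδRs : B₁ * ε₀ < (16 * 3800 * ((((2 + 1 + 2) * (ℓ + 1) : ℕ)) : ℝ) ^ 2 * ((ℓ + 1 : ℕ) : ℝ))⁻¹ / 4 := by
    linarith only [hδa, ha₃, ha₃R, hRcε, h3ε]
  have htE : C2f * (B₁ * ε₀) ^ 2 ≤ 4 * C2f * ε ^ 2 := by
    have h1 : (B₁ * ε₀) ^ 2 ≤ ε ^ 2 := pow_le_pow_left₀ hδ0 hδε 2
    have h2 : 0 ≤ C2f * ε ^ 2 := by positivity
    have h3 : C2f * (B₁ * ε₀) ^ 2 ≤ C2f * ε ^ 2 := mul_le_mul_of_nonneg_left h1 hC2f0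
    linarith only [h2, h3]
  have hballnum : a₃ + BH * (4 * C2f * ε ^ 2) ≤ (16 * 3800 * ((((2 + 1 + 2) * (ℓ + 1) : ℕ)) : ℝ) ^ 2 * ((ℓ + 1 : ℕ) : ℝ))⁻¹ := by
    have h1 : (1 + 4 * BH * C2f * ε) * ε = ε + BH * (4 * C2f * ε ^ 2) := by ring
    have h2 := HalvingDressingLetter.radFlat_le_quarter_Rs ℓ
    rw [h1] at hR'
    linarith only [hR', h2, ha₃R, hRcε, hRs0]
  -- the weights of record and the cube sequence's admissibility at this member
  set 𝒟 := cubeSeqMT3 (⟨ℓ + 1, hLF, m, hm⟩ : T3Family) n K x ρ S ((ℓ + 1) * (ℓ + 1) ^ a') hM with h𝒟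
  set w₀ : ℕ → PBond ((⟨ℓ + 1, hLF, m, hm⟩ : T3Family).P K) 0 → ℝ := fun m' b =>
    (((ℓ + 1 : ℕ) : ℝ) ^ levOf (fun j => {y : Site ((⟨ℓ + 1, hLF, m, hm⟩ : T3Family).P K) 0 | 𝒟.InOm j y}) (K - n) b.src *
      (((ℓ + 1 : ℕ) : ℝ)⁻¹) ^ (K - n)) ^ m' with hw₀def
  have hw : IsLevWeight (⟨ℓ + 1, hLF, m, hm⟩ : T3Family) n K 𝒟 w₀ := fun _ _ => rfl
  have hDk : 𝒟.k = K - n := cubeSeqMT3_k _ n K x ρ S _ hM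
  have hAdm : Adm22 𝒟 R ((ℓ + 1) * (ℓ + 1) ^ a') := adm22_cubeSeqMT3 _ n K x ρ hM hRS
  have hRL : 2 * ((⟨ℓ + 1, hLF, m, hm⟩ : T3Family).P K).L ≤ R := hR2L
  have hRM1 : 2 * ((⟨ℓ + 1, hLF, m, hm⟩ : T3Family).P K).L ≤ R * ((ℓ + 1) * (ℓ + 1) ^ a') + 1 := by
    show 2 * (ℓ + 1) ≤ R * ((ℓ + 1) * (ℓ + 1) ^ a') + 1
    omega
  have hcollar := Prop8Chart.collar_of_adm22 𝒟 hAdm hRM1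
  have hLS' : ℓ + 1 ≤ S := le_trans (by omega) (hRM.trans hRS)
  have hLS : (⟨ℓ + 1, hLF, m, hm⟩ : T3Family).L ≤ S := hLS'
  have hRsle : 16 * 3800 * ((((2 + 1 + 2) * (ℓ + 1) : ℕ)) : ℝ) ^ 2 * ((ℓ + 1 : ℕ) : ℝ) *
      (16 * 3800 * ((((2 + 1 + 2) * (ℓ + 1) : ℕ)) : ℝ) ^ 2 * ((ℓ + 1 : ℕ) : ℝ))⁻¹ ≤ 1 :=
    (mul_inv_cancel₀ hden.ne').le
  -- the P2 rows at the member (the text's `H` is the canonical `flatH`)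
  obtain ⟨H, Gt, hFH, -, -, -, -, dBI, hdom, h162, hHd⟩ :=
    hP2L ⟨ℓ + 1, hLF, m, hm⟩ rfl n K hnK R ((ℓ + 1) * (ℓ + 1) ^ a') hR₀ hM₀ ⟨a' + 1, by rw [pow_succ']⟩ 𝒟 hDk hAdm w₀ hw
  have hHeq : H = flatH (⟨ℓ + 1, hLF, m, hm⟩ : T3Family) n K 𝒟 :=
    LinearMap.ext fun X => funext fun b => (hFH X b).trans (isFlatH_flatH (F := ⟨ℓ + 1, hLF, m, hm⟩) (n := n) (K := K) (D := 𝒟) X b).symm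
  rw [hHeq] at hHd
  -- FILE E's objects at the member
  obtain ⟨Hs, Dsel, W₀, hHs, hHinv, hHrows, hE4, -, hE6, -, -, -, -, -, hE11, -, hE13⟩ :=
    hEall m hm n K (by omega) (by omega) (Mh := (ℓ + 1) ^ a') rfl hMhE hR₀E x ρ S hM hRS w₀ hw
  -- read FILE E's objects at the member's own carrier letters
  change (BondIdx 𝒟 → Matrix (Fin 2) (Fin 2) ℂ) →ₗ[ℂ] (PBond ((⟨ℓ + 1, hLF, m, hm⟩ : T3Family).P K) 0 → Matrix (Fin 2) (Fin 2) ℂ) at Hs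
  change (PBond ((⟨ℓ + 1, hLF, m, hm⟩ : T3Family).P K) 0 → Matrix (Fin 2) (Fin 2) ℂ) → BondIdx 𝒟 → Matrix (Fin 2) (Fin 2) ℂ at Dsel
  change (PBond ((⟨ℓ + 1, hLF, m, hm⟩ : T3Family).P K) 0 → Matrix (Fin 2) (Fin 2) ℂ) →
    (PBond ((⟨ℓ + 1, hLF, m, hm⟩ : T3Family).P K) 0 → Matrix (Fin 2) (Fin 2) ℂ) at W₀
  -- the member's (165) implication
  have h165 := h165all m hm n K (by omega) (by omega) (Mh := (ℓ + 1) ^ a') rfl hMhr hR₀r hM x ρ S hRS hρ1 w₀ hw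
  -- the SU(2) chart of 𝔰𝔲(2)-valued fields
  obtain ⟨Uc, hUc, hUcont⟩ := exists_su2Chart_continuous (P := (⟨ℓ + 1, hLF, m, hm⟩ : T3Family).P K) ((((ℓ + 1 : ℕ) : ℝ)⁻¹) ^ (K - n))
  -- the P1♭′ sizes at the weights of record
  obtain ⟨h1, h2⟩ := hiii w₀ hw
  -- B3: the size of `C♭ A`
  set C : (PBond ((⟨ℓ + 1, hLF, m, hm⟩ : T3Family).P K) 0 → Matrix (Fin 2) (Fin 2) ℂ) → BondIdx 𝒟 → Matrix (Fin 2) (Fin 2) ℂ := fun Y i =>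
    chartLogFlat ((((ℓ + 1 : ℕ) : ℝ)⁻¹) ^ (K - n)) 𝒟 Y i -
      (fderiv ℂ (chartLogFlat ((((ℓ + 1 : ℕ) : ℝ)⁻¹) ^ (K - n)) 𝒟 :
        (PBond ((⟨ℓ + 1, hLF, m, hm⟩ : T3Family).P K) 0 → Matrix (Fin 2) (Fin 2) ℂ) → BondIdx 𝒟 → Matrix (Fin 2) (Fin 2) ℂ) 0) Y i with hCdef
  have hCA : ∀ c, ‖C A c‖ ≤ C2f * (B₁ * ε₀) ^ 2 := fun c =>
    (chartRemainderFlat_hCd_hCq_B1 (⟨ℓ + 1, hLF, m, hm⟩ : T3Family) n K hRL hM 𝒟 hDk hAdm hw).2 A (B₁ * ε₀) hδRs h1 c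
  have hCA' : ∀ c, ‖C A c‖ ≤ 4 * C2f * ε ^ 2 := fun c => (hCA c).trans htE
  -- L1: the size of `A′ := A + Hs (C A)`; the ball
  have hAR : ∀ b, w₀ 1 b * ‖A b‖ < (16 * 3800 * ((((2 + 1 + 2) * (ℓ + 1) : ℕ)) : ℝ) ^ 2 * ((ℓ + 1 : ℕ) : ℝ))⁻¹ := fun b =>
    lt_of_le_of_lt (h1 b) (by linarith only [hδRs, hRs0])
  obtain ⟨-, -, -, hsz1, -⟩ := aPrime_rows (⟨ℓ + 1, hLF, m, hm⟩ : T3Family) n K 𝒟 hDk hRL hM hAdm hcollar hw Hs hHs (B₀ := BH)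
    (fun X t hX => (hHrows X t hX).1) (fun X t hX => (hHrows X t hX).2) hsa htr hiv (δ := B₁ * ε₀) (δ' := B₁ * ε₀)
    (R := (16 * 3800 * ((((2 + 1 + 2) * (ℓ + 1) : ℕ)) : ℝ) ^ 2 * ((ℓ + 1 : ℕ) : ℝ))⁻¹) hδRs h1 h2 hRsle hAR
  have hA'r₁ : ∀ b, w₀ 1 b * ‖(A + Hs (C A)) b‖ < a₃ := fun b => lt_of_le_of_lt (hsz1 b) hr_lt
  have hA'ε : ∀ b, w₀ 1 b * ‖(A + Hs (C A)) b‖ < ε := fun b => (hA'r₁ b).trans_le (ha₃R.trans hRcε.le)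
  have hballε : ∀ X : PBond ((⟨ℓ + 1, hLF, m, hm⟩ : T3Family).P K) 0 → Matrix (Fin 2) (Fin 2) ℂ,
      (∀ b, w₀ 1 b * ‖X b‖ < a₃) → ∀ b, w₀ 1 b * ‖X b‖ < ε := fun X hX b => (hX b).trans_le (ha₃R.trans hRcε.le)
  have hw1 : ∀ b, 0 ≤ w₀ 1 b := fun b => levWeight_nonneg hw 1 b
  have hball : ∀ X : PBond ((⟨ℓ + 1, hLF, m, hm⟩ : T3Family).P K) 0 → Matrix (Fin 2) (Fin 2) ℂ, (∀ b, w₀ 1 b * ‖X b‖ < a₃) →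
      ∀ b, w₀ 1 b * ‖(X - Hs (Dsel X)) b‖ < (16 * 3800 * ((((2 + 1 + 2) * (ℓ + 1) : ℕ)) : ℝ) ^ 2 * ((ℓ + 1 : ℕ) : ℝ))⁻¹ := by
    intro X hX b
    have hsz := (hE6 X (hballε X hX)).1
    have hrow : w₀ 1 b * ‖Hs (Dsel X) b‖ ≤ BH * (4 * C2f * ε ^ 2) := (hHrows (Dsel X) _ hsz).1 b
    have hsub : ‖(X - Hs (Dsel X)) b‖ ≤ ‖X b‖ + ‖Hs (Dsel X) b‖ := by rw [Pi.sub_apply]; exact norm_sub_le _ _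
    have h3 := mul_le_mul_of_nonneg_left hsub (hw1 b)
    rw [mul_add] at h3
    linarith only [hX b, hrow, h3, hballnum]
  -- the identification `Dsel A′ = C A` and the chart identity for `A′ − Hs (Dsel A′) = A`
  have h49A : chartLogFlat ((((ℓ + 1 : ℕ) : ℝ)⁻¹) ^ (K - n)) 𝒟 ((A + Hs (C A)) - Hs (C A)) -
      (fderiv ℂ (chartLogFlat ((((ℓ + 1 : ℕ) : ℝ)⁻¹) ^ (K - n)) 𝒟 :
        (PBond ((⟨ℓ + 1, hLF, m, hm⟩ : T3Family).P K) 0 → Matrix (Fin 2) (Fin 2) ℂ) → BondIdx 𝒟 → Matrix (Fin 2) (Fin 2) ℂ) 0) ((A + Hs (C A)) - Hs (C A)) =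
      C A := by
    rw [add_sub_cancel_right]
    rfl
  have hDA : Dsel (A + Hs (C A)) = C A := ((hE6 _ hA'ε).2.2.2.1 (C A) hCA' h49A).symm
  have hZA : (A + Hs (C A)) - Hs (Dsel (A + Hs (C A))) = A := by rw [hDA, add_sub_cancel_right]
  -- F2: the □₀ geometry and the SU(2) normalisation of the P1♭′ chart
  obtain ⟨uS, hchartNear⟩ := hchartNear_of_hii' (n := n) x ρ S ((ℓ + 1) * (ℓ + 1) ^ a') U u A htr hii
  -- (Φ-1′): the ∃-gauge fibre half, DISCHARGED by ✓`exists_gaugeAct_mem_fibre_of_chart49`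
  have hΦ1 : ∀ X ∈ {X : PBond ((⟨ℓ + 1, hLF, m, hm⟩ : T3Family).P K) 0 → Matrix (Fin 2) (Fin 2) ℂ | (∀ b, IsSelfAdjoint (X b)) ∧ (∀ b, Matrix.trace (X b) = 0) ∧
        (∀ c : BondIdx 𝒟, bondAvgIter (c.1.1 : ℕ) X c.1.2 = bondAvgIter (c.1.1 : ℕ) (A + Hs (C A)) c.1.2) ∧
        X ∈ {Y : PBond ((⟨ℓ + 1, hLF, m, hm⟩ : T3Family).P K) 0 → Matrix (Fin 2) (Fin 2) ℂ | ∀ b, w₀ 1 b * ‖Y b‖ < a₃}},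
      RegPr (⟨ℓ + 1, hLF, m, hm⟩ : T3Family) n K ε₀ (fun b => if (b.src ∈ cubeSetM x (K - n) ρ S ((ℓ + 1) * (ℓ + 1) ^ a') 0 ∧ b.tgt ∈ cubeSetM x (K - n) ρ S ((ℓ + 1) * (ℓ + 1) ^ a') 0)
        then Uc (X - Hs (Dsel X)) b else GaugeField.gaugeAct uS U b) →
      ∃ h : GaugeTransf ((⟨ℓ + 1, hLF, m, hm⟩ : T3Family).P K) 0 (Matrix.specialUnitaryGroup (Fin 2) ℂ),
        GaugeField.gaugeAct h (fun b => if (b.src ∈ cubeSetM x (K - n) ρ S ((ℓ + 1) * (ℓ + 1) ^ a') 0 ∧ b.tgt ∈ cubeSetM x (K - n) ρ S ((ℓ + 1) * (ℓ + 1) ^ a') 0)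
          then Uc (X - Hs (Dsel X)) b else GaugeField.gaugeAct uS U b) ∈
          T3ConstrainedMinimiser.fibre (⟨ℓ + 1, hLF, m, hm⟩ : T3Family) T3UnitLawDensityEML.ℰp n K hnK.le V := by
    intro X hX hreg
    obtain ⟨hXsa, hXtr, hXQ, hXS⟩ := hX
    have hXS' : ∀ b, w₀ 1 b * ‖X b‖ < a₃ := hXS
    -- the dressed competitor is 𝔰𝔲(2)-valued
    have hdX := dressed_competitor_su2 (⟨ℓ + 1, hLF, m, hm⟩ : T3Family) n K 𝒟 hDk hcollar hw hRsle (⇑Hs)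
      (fun b c => flatH (⟨ℓ + 1, hLF, m, hm⟩ : T3Family) n K 𝒟 (Pi.single c 1) b *
        (((ℓ + 1 : ℕ) : ℝ) ^ (c.1.1 : ℕ) * (((ℓ + 1 : ℕ) : ℝ)⁻¹) ^ (K - n))⁻¹)
      hHs hXsa hXtr (hball X hXS') (hE6 X (hballε X hXS')).2.1 (hE6 X (hballε X hXS')).1 (hE6 X (hballε X hXS')).2.2.2.1
    exact exists_gaugeAct_mem_fibre_of_chart49 𝒟 hDk hcollar hw hRsle Hs Dsel (r₁ := a₃)
      (fun Y hY => (hE6 Y (hballε Y hY)).2.1) hHinv hball hA'r₁ hXS' hXQ hnK.le hε₀ hε7 hU uS _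
      (near_of_bondIdx _ n K x ρ S _ hM hLS) (near_of_mem_Om_succ _ n K x ρ S _ hM)
      (fun b hb => by rw [hZA]; exact hchartNear b hb) _
      (fun b hb => by simp only [if_pos hb]; exact hUc _ hdX.1 hdX.2 b) (fun b hb => by simp only [if_neg hb]) hreg
  -- L3′
  obtain ⟨h165rows, h157, hnear, hfar⟩ := ceRows_at_member_exists (⟨ℓ + 1, hLF, m, hm⟩ : T3Family) n K hnK x ρ S ((ℓ + 1) * (ℓ + 1) ^ a') R hM hρ1
    hRS hRM hRL hw hHd h162 hdom hδ₀.le hB₀.le hB₃.le hsa htr hiv (δ := B₁ * ε₀) (ε₁ := ε₁) hδ0 h1 h2 hvi Hs hHs hHinv hBH hHrows Dsel hE4 hE6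
    W₀ hE11 (by positivity) hE13 h165 Uc hUc hUcont
    (fun b => b.src ∈ cubeSetM x (K - n) ρ S ((ℓ + 1) * (ℓ + 1) ^ a') 0 ∧ b.tgt ∈ cubeSetM x (K - n) ρ S ((ℓ + 1) * (ℓ + 1) ^ a') 0)
    _ (near_sides_of_touch (n := n) x ρ S _ hM (le_trans (by omega) hLS')) (lamBond_sides_of_not_touch 𝒟) ε₀ V hmin hε₀.le hU uS hchartNear hΦ1
    hδRs (ha₃R.trans hRcε.le) hr_lt hr_lt htE hballnum
  have he₃ : ∀ q : ℝ, q = C2f → B₀ * B₃ * (q * (B₁ * ε₀) ^ 2) ≤ B₀ * B₃ * C2f * B₁ ^ 2 * ε₀ ^ 2 :=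
    fun q hq => by subst hq; exact le_of_eq (by ring)
  refine ⟨⇑Hs, C, _, _, h165rows, h157, hnear, fun c hc => (hfar c hc).trans ?_, ?_, he₃ _ rfl⟩
  · -- far: `L·r·L^{k−j} ≤ C₂ε₀·L^{k−j}`
    exact mul_le_mul_of_nonneg_right ((mul_le_mul_of_nonneg_left (r_le_of_delta_le_one hBH hC2f0 le_rfl hB₁ hε₀.le hδ1) hL0.le).trans_eq
      (by ring)) (by positivity)
  · -- `e₁ ≤ K₁ε₀²`
    exact e₁_bound hB₀r hBH (by positivity) le_rfl hC2f0 le_rfl hB₁ hε₀.le hδ1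

end Summit.QuantumFields.YangMills.Theorems.HalvingSitePackage

end
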